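import Literature.NumberTheory.GelbartRogawski1991.Prop311RhoPsiUnique
import HarnessLib

/-!
# [GelbartRogawski1991, §3.1 p. 454 L25–27]: `Mp_𝐀(W) ⟶π Sp_𝐀(W) ⟶ 0` — every `g ∈ Sp_𝐀(W)` lifts, for the PRINTED `ρ_ψ`

Topic `NumberTheory/GelbartRogawski1991`; namespace `Literature.NumberTheory.GelbartRogawski1991.Prop311`.  KERNEL
ONLY: theorems; no definition, no named fact, no `sorry`; `Prop311AsPrinted` itself is untouched.

[GelbartRogawski1991, §3.1 p. 454 L21–27] (verbatim): "*We define the global metaplectic group `Mp_𝐀(W)` as the group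
of pairs `(g, M_g)` where `g ∈ Sp_𝐀(W)` and `M_g` is an operator on the space of `ρ_ψ` such that
`M_g ρ_ψ(h) M_g⁻¹ = ρ_ψ(g(h))` for all `h ∈ H(𝐀)`. … The projection `π((g, M_g)) = g` yields an exact sequence
`0 ⟶ ℂ* ⟶ Mp_𝐀(W) ⟶π Sp_𝐀(W) ⟶ 0`.*"  The statement-exact typing `Prop311AsPrinted` renders `Mp_𝐀(W)`, `π` as
`Prop311.adelicMp`, `Prop311.proj` and records (module docstring, "NOT rendered") that the exactness is "a printed
CLAIM about the objects, not a hypothesis of 3.1.1 — consumers needing it must prove it for their `ρ_ψ`".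

This file proves the claim for EVERY printed model `ρ_ψ` (irreducible, unitary, continuous, central character `ψ`,
on a Hilbert space `S ≠ 0`):
* exactness on the right, **`proj_surjective`**: every `g ∈ Sp_𝐀(W)` has an implementer `M_g` — by the uniqueness of
  `ρ_ψ` (`Prop311RhoPsiUnique.rho_unique`) applied to `ρ_ψ` and its twist `ρ_ψ ∘ g` (`Sp_𝐀(W)` acts on `H_𝐀(W)` by
  `(w, t) ↦ (g w, t)`, `act_eq`, because `½ φ_𝐀` is alternating, `heisForm_self`), the intertwiner being unitary
  (`exists_mem_adelicMp_isometry`);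
* exactness in the middle and on the left (`proj_eq_one_iff`, with GR-2's Schur-lemma kernel computation
  `exists_eq_one_scalarOp_of_proj_eq_one` of `Prop311RationalSplittingUnique`, and `scalarOp_injective`);
* the packaged statement **`exists_isCentralExt`**: `ℂˣ ↪ Mp_𝐀(W) ↠ Sp_𝐀(W)` is a central extension in the sense of
  the tree's `MoeglinVignerasWaldspurger1987.IsCentralExt`.

## References
* [GelbartRogawski1991] S. Gelbart, J. Rogawski, Invent. Math. 105 (1991), §3.1 p. 454 L21–27.
* [Weil1964] A. Weil, Acta Math. 111 (1964), Chap. I n° 5, Chap. III n° 34–37 (`B₀(G)`, the lifts of `Sp`).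
* [MoeglinVignerasWaldspurger1987] C. Mœglin, M.-F. Vignéras, J.-L. Waldspurger, LNM 1291 (1987), Chap. 2 II.1–II.2.
-/

set_option autoImplicit false

noncomputable section

open NumberField IsDedekindDomain Filter Topology
open Literature.RepresentationTheory.HeisenbergGroup Literature.NumberTheory.Automorphic

namespace Literature.NumberTheory.GelbartRogawski1991

namespace Prop311

variable (F : Type) [Field F] [NumberField F]
variable (E : Type) [Field E] [Algebra F E]
variable (V : Type) [AddCommGroup V] [Module F V]
variable (Φ : V →ₗ[F] V →ₗ[F] E)

/-! ## §1 `Sp_𝐀(W)` acts on `H_𝐀(W)` by `(w, t) ↦ (g w, t)` -/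

/-- **`heisForm = ½ φ_𝐀` is alternating** (in adelic Darboux coordinates it is `½ (x · y − x · y)`).
[cite: GelbartRogawski1991, §3.1 p. 454 L17–19] -/
theorem heisForm_self [FiniteDimensional F V] (hφa : (traceForm F E V Φ).IsAlt)
    (hφ : (traceForm F E V Φ).Nondegenerate) (w : AdelicSpace F V) : heisForm F E V Φ w w = 0 := by
  obtain ⟨n, e, he⟩ := exists_adelicDarboux F E V Φ hφa hφ
  obtain ⟨c, rfl⟩ := e.surjective w
  rw [heisForm_coord he, sub_self, mul_zero]

/-- **the action of `Sp_𝐀(W)` on `H_𝐀(W)`** through Weil's section `ofSymplectic` is `(w, t) ↦ (g w, t)` (the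
correction term `½ (B(gw, gw) − B(w, w))` vanishes for the alternating `B = ½ φ_𝐀`): print's "`Sp(W)` acts as a group
of automorphisms of `H(W)`, fixing the center elementwise". [cite: GelbartRogawski1991, §3.1 p. 454 L18–19] -/
theorem act_eq [FiniteDimensional F V] (hφa : (traceForm F E V Φ).IsAlt) (hφ : (traceForm F E V Φ).Nondegenerate)
    (g : adelicSp F E V Φ) (h : AdelicHeisenberg F E V Φ) :
    (ofSymplectic (heisForm F E V Φ) g).act h =
      (⟨(g : AdelicSpace F V ≃ₗ[AdeleRing (𝓞 F) F] AdelicSpace F V) h.v, h.t⟩ : AdelicHeisenberg F E V Φ) := by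
  apply Heisenberg.ext
  · rfl
  · rw [Heisenberg.PseudoSymplectic.act_t, ofSymplectic_f, heisForm_self F E V Φ hφa hφ,
      heisForm_self F E V Φ hφa hφ, sub_self, mul_zero, add_zero]

/-- the action map `h ↦ g · h` is continuous for the adelic topology of `H_𝐀(W)` (`g` is `𝐀`-linear on the finite
free `𝐀`-module `W_𝐀` with its module topology). [cite: GelbartRogawski1991, Prop. 3.1.1 p. 455 L1–2] -/
theorem continuous_act [FiniteDimensional F V] (hφa : (traceForm F E V Φ).IsAlt)
    (hφ : (traceForm F E V Φ).Nondegenerate) (g : adelicSp F E V Φ) :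
    @Continuous _ _ (heisenbergTopology F E V Φ) (heisenbergTopology F E V Φ)
      fun h => (ofSymplectic (heisForm F E V Φ) g).act h := by
  have hv : @Continuous (AdelicHeisenberg F E V Φ) (AdelicSpace F V) (heisenbergTopology F E V Φ)
      (adelicSpaceTopology F V) fun h => h.v :=
    continuous_heisenberg_v (heisForm F E V Φ) (adelicSpaceTopology F V) inferInstance
  have ht : @Continuous (AdelicHeisenberg F E V Φ) (AdeleRing (𝓞 F) F) (heisenbergTopology F E V Φ)
      inferInstance fun h => h.t :=
    continuous_heisenberg_t (heisForm F E V Φ) (adelicSpaceTopology F V) inferInstance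
  have hg : @Continuous (AdelicSpace F V) (AdelicSpace F V) (adelicSpaceTopology F V) (adelicSpaceTopology F V)
      fun w => (g : AdelicSpace F V ≃ₗ[AdeleRing (𝓞 F) F] AdelicSpace F V) w := by
    letI tW : TopologicalSpace (AdelicSpace F V) := adelicSpaceTopology F V
    haveI : IsModuleTopology (AdeleRing (𝓞 F) F) (AdelicSpace F V) := ⟨rfl⟩
    haveI : ContinuousAdd (AdelicSpace F V) :=
      IsModuleTopology.toContinuousAdd (AdeleRing (𝓞 F) F) (AdelicSpace F V)
    exact IsModuleTopology.continuous_of_linearMap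
      ((g : AdelicSpace F V ≃ₗ[AdeleRing (𝓞 F) F] AdelicSpace F V) :
        AdelicSpace F V →ₗ[AdeleRing (𝓞 F) F] AdelicSpace F V)
  rw [show (fun h => (ofSymplectic (heisForm F E V Φ) g).act h) = fun h : AdelicHeisenberg F E V Φ =>
      (⟨(g : AdelicSpace F V ≃ₗ[AdeleRing (𝓞 F) F] AdelicSpace F V) h.v, h.t⟩ : AdelicHeisenberg F E V Φ) from
    funext (act_eq F E V Φ hφa hφ g)]
  exact @continuous_heisenberg_mk _ _ (AdelicHeisenberg F E V Φ) _ _ _ (heisForm F E V Φ) (adelicSpaceTopology F V)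
    inferInstance (heisenbergTopology F E V Φ) _ _
    (@Continuous.comp _ _ _ (heisenbergTopology F E V Φ) (adelicSpaceTopology F V) (adelicSpaceTopology F V) _ _
      hg hv) ht

/-! ## §2 Every `g ∈ Sp_𝐀(W)` lifts to `Mp_𝐀(W)` -/

/-- **every symplectic `g` has a UNITARY implementer** on any printed model of `ρ_ψ`: there is `(g, M) ∈ Mp_𝐀(W)`
with `M` a linear isometry — `ρ_ψ ∘ g` is again an irreducible unitary `ψ`-representation, so it is unitarily
equivalent to `ρ_ψ` (`rho_unique`). [cite: GelbartRogawski1991, §3.1 p. 454 L21–27] -/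
theorem exists_mem_adelicMp_isometry [Algebra.IsQuadraticExtension F E] (σ : E ≃ₐ[F] E)
    (ψ : AddChar (AdeleRing (𝓞 F) F) Circle) (hψc : Continuous ψ)
    (hψF : ∀ x : F, ψ (algebraMap F (AdeleRing (𝓞 F) F) x) = 1) (hψ1 : ψ ≠ 1)
    [Module E V] [IsScalarTower F E V] [FiniteDimensional E V]
    (hΦ₃ : ∀ x y : V, Φ y x = -σ (Φ x y)) (hφ : (traceForm F E V Φ).Nondegenerate)
    {S : Type} [NormedAddCommGroup S] [InnerProductSpace ℂ S] [CompleteSpace S] [Nontrivial S]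
    (ρ : Representation ℂ (AdelicHeisenberg F E V Φ) S)
    (hρu : ∀ (h : AdelicHeisenberg F E V Φ) (f : S), ‖ρ h f‖ = ‖f‖)
    (hρc : ∀ f : S, @Continuous _ _ (heisenbergTopology F E V Φ) _ fun h => ρ h f)
    (hρi : ∀ K : Submodule ℂ S, IsClosed (K : Set S) →
      (∀ (h : AdelicHeisenberg F E V Φ), ∀ f ∈ K, ρ h f ∈ K) → K = ⊥ ∨ K = ⊤)
    (hρz : ∀ (t : AdeleRing (𝓞 F) F) (f : S),
      ρ (Heisenberg.ofCenter (heisForm F E V Φ) (Multiplicative.ofAdd t)) f = ((ψ t : Circle) : ℂ) • f)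
    (g : adelicSp F E V Φ) :
    ∃ U : S ≃ₗᵢ[ℂ] S, ((g, (U.toLinearEquiv : S ≃ₗ[ℂ] S)) : adelicSp F E V Φ × (S ≃ₗ[ℂ] S)) ∈ adelicMp F E V Φ ρ := by
  haveI : FiniteDimensional F V := finite_restrictScalars F E V
  have hφa : (traceForm F E V Φ).IsAlt := isAlt_traceForm F E V Φ σ hΦ₃
  letI tH : TopologicalSpace (AdelicHeisenberg F E V Φ) := heisenbergTopology F E V Φ
  set s : Heisenberg.PseudoSymplectic (heisForm F E V Φ) := ofSymplectic (heisForm F E V Φ) g with hs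
  -- the twisted representation `ρ ∘ g`
  let ρg : Representation ℂ (AdelicHeisenberg F E V Φ) S :=
    ρ.comp (Heisenberg.PseudoSymplectic.toAut s).toMonoidHom
  have hρg : ∀ h, ρg h = ρ (s.act h) := fun h => rfl
  have hgu : ∀ (h : AdelicHeisenberg F E V Φ) (f : S), ‖ρg h f‖ = ‖f‖ := fun h f => hρu _ f
  have hgc : ∀ f : S, Continuous fun h => ρg h f := fun f =>
    (hρc f).comp (continuous_act F E V Φ hφa hφ g)
  have hgi : ∀ K : Submodule ℂ S, IsClosed (K : Set S) →
      (∀ (h : AdelicHeisenberg F E V Φ), ∀ f ∈ K, ρg h f ∈ K) → K = ⊥ ∨ K = ⊤ := by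
    intro K hKc hK
    refine hρi K hKc fun h f hf => ?_
    have h1 : ρ h f = ρg (s⁻¹.act h) f := by
      rw [hρg, ← Heisenberg.PseudoSymplectic.act_mul_act, mul_inv_cancel, Heisenberg.PseudoSymplectic.act_one]
    rw [h1]
    exact hK _ f hf
  have hgz : ∀ (t : AdeleRing (𝓞 F) F) (f : S),
      ρg (Heisenberg.ofCenter (heisForm F E V Φ) (Multiplicative.ofAdd t)) f = ((ψ t : Circle) : ℂ) • f := by
    intro t f
    rw [hρg, ← Heisenberg.PseudoSymplectic.toAut_apply, Heisenberg.PseudoSymplectic.toAut_ofCenter, hρz]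
  obtain ⟨U, hU, -⟩ := rho_unique F E σ ψ hψc hψF hψ1 V Φ hΦ₃ hφ S ρ hρu hρc hρi hρz S ρg hgu hgc hgi hgz
  refine ⟨U, Subgroup.mem_inf.2 ⟨?_, ?_⟩⟩
  · -- condition (A): `U ρ(h) = ρ(g · h) U`
    rw [mem_MpPsi]
    intro h f
    exact hU h f
  · -- `U`, `U⁻¹` are bounded
    rw [Subgroup.mem_comap]
    exact ⟨U.continuous, U.symm.continuous⟩

/-- **`π : Mp_𝐀(W) → Sp_𝐀(W)` is onto** for every printed model of `ρ_ψ` — exactness of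
"`Mp_𝐀(W) ⟶π Sp_𝐀(W) ⟶ 0`". [cite: GelbartRogawski1991, §3.1 p. 454 L25–27] -/
theorem proj_surjective [Algebra.IsQuadraticExtension F E] (σ : E ≃ₐ[F] E)
    (ψ : AddChar (AdeleRing (𝓞 F) F) Circle) (hψc : Continuous ψ)
    (hψF : ∀ x : F, ψ (algebraMap F (AdeleRing (𝓞 F) F) x) = 1) (hψ1 : ψ ≠ 1)
    [Module E V] [IsScalarTower F E V] [FiniteDimensional E V]
    (hΦ₃ : ∀ x y : V, Φ y x = -σ (Φ x y)) (hφ : (traceForm F E V Φ).Nondegenerate)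
    {S : Type} [NormedAddCommGroup S] [InnerProductSpace ℂ S] [CompleteSpace S] [Nontrivial S]
    (ρ : Representation ℂ (AdelicHeisenberg F E V Φ) S)
    (hρu : ∀ (h : AdelicHeisenberg F E V Φ) (f : S), ‖ρ h f‖ = ‖f‖)
    (hρc : ∀ f : S, @Continuous _ _ (heisenbergTopology F E V Φ) _ fun h => ρ h f)
    (hρi : ∀ K : Submodule ℂ S, IsClosed (K : Set S) →
      (∀ (h : AdelicHeisenberg F E V Φ), ∀ f ∈ K, ρ h f ∈ K) → K = ⊥ ∨ K = ⊤)
    (hρz : ∀ (t : AdeleRing (𝓞 F) F) (f : S),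
      ρ (Heisenberg.ofCenter (heisForm F E V Φ) (Multiplicative.ofAdd t)) f = ((ψ t : Circle) : ℂ) • f) :
    Function.Surjective (proj F E V Φ ρ) := by
  intro g
  obtain ⟨U, hU⟩ := exists_mem_adelicMp_isometry F E V Φ σ ψ hψc hψF hψ1 hΦ₃ hφ ρ hρu hρc hρi hρz g
  exact ⟨⟨_, hU⟩, rfl⟩

/-! ## §3 The kernel: `0 ⟶ ℂ* ⟶ Mp_𝐀(W) ⟶π` -/

omit [NumberField F] in
/-- `c ↦ c · id` is injective on the non-zero space of `ρ_ψ` — exactness of "`0 ⟶ ℂ* ⟶ Mp_𝐀(W)`".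
[cite: GelbartRogawski1991, §3.1 p. 454 L25–27] -/
theorem scalarOp_injective {S : Type} [AddCommGroup S] [Module ℂ S] [Nontrivial S] :
    Function.Injective fun c : ℂˣ => scalarOp (S := S) c := by
  intro c c' h
  obtain ⟨f, hf⟩ := exists_ne (0 : S)
  have h1 : (c : ℂ) • f = (c' : ℂ) • f := by
    rw [← scalarOp_apply, ← scalarOp_apply]
    exact congrArg (fun M : S ≃ₗ[ℂ] S => M f) h
  exact Units.ext (smul_left_injective ℂ hf h1)

/-- **the kernel of `π` is `ℂ*`** (exactness at `Mp_𝐀(W)`): `π(p) = 1` iff `p = (1, c · id)` for a (unique) `c ∈ ℂˣ`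
— Schur's lemma for the irreducible unitary `ρ_ψ` (GR-2's `exists_eq_one_scalarOp_of_proj_eq_one`).
[cite: GelbartRogawski1991, §3.1 p. 454 L25–27] -/
theorem proj_eq_one_iff {S : Type} [NormedAddCommGroup S] [InnerProductSpace ℂ S] [CompleteSpace S]
    (ρ : Representation ℂ (AdelicHeisenberg F E V Φ) S)
    (hρu : ∀ (h : AdelicHeisenberg F E V Φ) (f : S), ‖ρ h f‖ = ‖f‖)
    (hρi : ∀ K : Submodule ℂ S, IsClosed (K : Set S) →
      (∀ (h : AdelicHeisenberg F E V Φ), ∀ f ∈ K, ρ h f ∈ K) → K = ⊥ ∨ K = ⊤)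
    (p : adelicMp F E V Φ ρ) :
    proj F E V Φ ρ p = 1 ↔ ∃ c : ℂˣ, (p : adelicSp F E V Φ × (S ≃ₗ[ℂ] S)) = (1, scalarOp c) := by
  constructor
  · exact exists_eq_one_scalarOp_of_proj_eq_one F E V Φ ρ hρu hρi p
  · rintro ⟨c, hc⟩
    change (p : adelicSp F E V Φ × (S ≃ₗ[ℂ] S)).1 = 1
    rw [hc]

/-! ## §4 The printed exact sequence as a central extension -/

/-- **"`0 ⟶ ℂ* ⟶ Mp_𝐀(W) ⟶π Sp_𝐀(W) ⟶ 0`" is a central extension** (the tree's predicate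
`MoeglinVignerasWaldspurger1987.IsCentralExt`: central image, `ker π ⊆ ℂ*`, `π` onto) for EVERY printed model of
`ρ_ψ`, with `ℂˣ ↪ Mp_𝐀(W)`, `c ↦ (1, c · id)`. [cite: GelbartRogawski1991, §3.1 p. 454 L25–27] -/
theorem exists_isCentralExt [Algebra.IsQuadraticExtension F E] (σ : E ≃ₐ[F] E)
    (ψ : AddChar (AdeleRing (𝓞 F) F) Circle) (hψc : Continuous ψ)
    (hψF : ∀ x : F, ψ (algebraMap F (AdeleRing (𝓞 F) F) x) = 1) (hψ1 : ψ ≠ 1)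
    [Module E V] [IsScalarTower F E V] [FiniteDimensional E V]
    (hΦ₃ : ∀ x y : V, Φ y x = -σ (Φ x y)) (hφ : (traceForm F E V Φ).Nondegenerate)
    {S : Type} [NormedAddCommGroup S] [InnerProductSpace ℂ S] [CompleteSpace S] [Nontrivial S]
    (ρ : Representation ℂ (AdelicHeisenberg F E V Φ) S)
    (hρu : ∀ (h : AdelicHeisenberg F E V Φ) (f : S), ‖ρ h f‖ = ‖f‖)
    (hρc : ∀ f : S, @Continuous _ _ (heisenbergTopology F E V Φ) _ fun h => ρ h f)
    (hρi : ∀ K : Submodule ℂ S, IsClosed (K : Set S) →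
      (∀ (h : AdelicHeisenberg F E V Φ), ∀ f ∈ K, ρ h f ∈ K) → K = ⊥ ∨ K = ⊤)
    (hρz : ∀ (t : AdeleRing (𝓞 F) F) (f : S),
      ρ (Heisenberg.ofCenter (heisForm F E V Φ) (Multiplicative.ofAdd t)) f = ((ψ t : Circle) : ℂ) • f) :
    ∃ i : ℂˣ →* adelicMp F E V Φ ρ,
      (∀ c : ℂˣ, ((i c : adelicMp F E V Φ ρ) : adelicSp F E V Φ × (S ≃ₗ[ℂ] S)) = (1, scalarOp c)) ∧
      Function.Injective i ∧
      Literature.RepresentationTheory.MoeglinVignerasWaldspurger1987.IsCentralExt i (proj F E V Φ ρ) := by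
  let j : ℂˣ →* adelicSp F E V Φ × (S ≃ₗ[ℂ] S) :=
    MonoidHom.prod 1 (DistribMulAction.toModuleAut ℂ S)
  have hj : ∀ c : ℂˣ, j c = (1, scalarOp c) := fun c => rfl
  let i : ℂˣ →* adelicMp F E V Φ ρ :=
    j.codRestrict (adelicMp F E V Φ ρ) fun c => by
      rw [hj]
      exact one_scalarOp_mem_adelicMp F E V Φ ρ c
  have hi : ∀ c : ℂˣ, ((i c : adelicMp F E V Φ ρ) : adelicSp F E V Φ × (S ≃ₗ[ℂ] S)) = (1, scalarOp c) :=
    fun c => rfl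
  refine ⟨i, hi, fun c c' h => scalarOp_injective (S := S) ?_, fun c => ?_, fun p hp => ?_,
    proj_surjective F E V Φ σ ψ hψc hψF hψ1 hΦ₃ hφ ρ hρu hρc hρi hρz⟩
  · have := congrArg (fun q : adelicMp F E V Φ ρ => (q : adelicSp F E V Φ × (S ≃ₗ[ℂ] S)).2) h
    simpa only [hi] using this
  · exact mem_center_of_proj_eq_one F E V Φ ρ hρu hρi (i c) rfl
  · obtain ⟨c, hc⟩ := (proj_eq_one_iff F E V Φ ρ hρu hρi p).1 hp
    exact ⟨c, Subtype.ext ((hi c).trans hc.symm)⟩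

end Prop311

end Literature.NumberTheory.GelbartRogawski1991

end
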